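import Mathlib
import HarnessLib.Audit
import Summits.PneNP.PneNP.Theorems.PstarChordReadTwoClean
import Summits.PneNP.PneNP.Theorems.PstarTerminalPeelableGeneric

/-!
# After the clean two-chord theorem: only DIRTY chords count; O1 from `TwoCleanGeneric` (ROUND-24, O1; memo g23 §25)

FRONTIER range-avoidance ladder, rung F-N3, ROUND 24 (cell `pnp-ideate`, prover-2 memo `g23/O1-TWOCLEAN-g23.md` §25; typed target
`PstarCoreBoundTargets.TerminalPeelable` (p646951); restricted-model proof complexity — nothing here bears on `P` versus `NP`).

`PstarChordReadTwoClean.false_of_two_clean` kills ANY two outside-gated slice-generic chords of a terminal core.  Consequences: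

* `false_of_generic_of_dirty` — **`#dirty + 2` slice-generic chords kill**: a set of slice-generic chords with two more members than its
  dirty members contains two clean ones;
* `card_dirty_le_slack` — the DIRTY chords (not outside-gated: some menu monomial pairs a private with a variable read inside the core) of a
  terminal core with `2·#bdry J₀ ≤ 3·#J₀ + t` number at most `t` (the boundary count `PstarChordReadSlackCount.card_le_slack'` for the family of
  inside partners alone — no matching, no hub gates);
* `exists_two_clean_of_generic` — hence among `t + 2` chords two are clean (this re-derives `PstarChordReadSlackGeneral.false_of_generic_chords`
  in two lines: no matching, no hub gates);
* `TwoCleanGeneric` (OPEN, census side): every terminal core with a centre cycle has two distinct outside-gated slice-generic chords;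
  `twoCleanGeneric_of_genericChords : GenericChords → TwoCleanGeneric` and **`terminalPeelable_of_twoCleanGeneric : TwoCleanGeneric →
  TerminalPeelable`** — the O1 target now rests on this weaker node.  What separates it from "two slice-generic chords" is exactly the DIRTY
  chords (inside partners `{v, w}`, `w` a core AND variable), the last two-chord configuration not read by the chord-read programme.

No Assumption A.
-/

set_option linter.dupNamespace false -- `Summit.PneNP.PneNP.…`: summit = sub-problem name (D-0017 single-conjunct layout)

open Finset Literature.Computability.Complexity
open Summit.PneNP.PneNP.Theorems.PstarTyped (Typed)
open Summit.PneNP.PneNP.Theorems.PstarSALevel (varSet bdry BoundaryExpanding SimpleOverlap)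
open Summit.PneNP.PneNP.Theorems.PstarXCore (xverts)
open Summit.PneNP.PneNP.Theorems.PstarChordRepair (IsChord)
open Summit.PneNP.PneNP.Theorems.PstarCoreBoundTargets (Terminal TerminalPeelable)
open Summit.PneNP.PneNP.Theorems.PstarChordBridgeTools (xpdeg)
open Summit.PneNP.PneNP.Theorems.PstarChordReadLemma (SliceGeneric)
open Summit.PneNP.PneNP.Theorems.PstarChordReadOutside (OutsideGated)
open Summit.PneNP.PneNP.Theorems.PstarChordReadTight (not_mem_and_card)
open Summit.PneNP.PneNP.Theorems.PstarChordReadSlackOne (exists_inside_partner)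
open Summit.PneNP.PneNP.Theorems.PstarChordReadSlackTwo (priv_mem priv_ne)
open Summit.PneNP.PneNP.Theorems.PstarChordReadSlackCount (card_le_slack')
open Summit.PneNP.PneNP.Theorems.PstarTerminalPeelableTwelve (exists_centre_of_not_peelable)
open Summit.PneNP.PneNP.Theorems.PstarTerminalPeelableGeneric (GenericChords)
open Summit.PneNP.PneNP.Theorems.PstarChordReadTwoClean (false_of_two_clean)

namespace Summit.PneNP.PneNP.Theorems.PstarChordReadTwoCleanCount

variable {n m : ℕ} {I : LocalMap 4 n m} {r : ℕ} {y : Fin m → Bool} {J₀ : Finset (Fin m)} {w₁ w₂ : Finset (Fin n) × Finset (Fin m) × Bool}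

/-- **`#dirty + 2` SLICE-GENERIC CHORDS KILL**: if a set `𝒞` of slice-generic chords has at least two more members than a set `𝒟` containing
its dirty (not outside-gated) members, the terminal core is contradictory — two members of `𝒞 ∖ 𝒟` are clean. -/
theorem false_of_generic_of_dirty (hI : I.IsPure xorAndPred) (hT : Typed I) (hS : SimpleOverlap I) (hB : BoundaryExpanding r I)
    (ht : Terminal I r y J₀ w₁ w₂) {𝒞 𝒟 : Finset (Fin m)} (h𝒞J : 𝒞 ⊆ J₀) (hch : ∀ c ∈ 𝒞, IsChord I J₀ c)
    (hgen : ∀ c ∈ 𝒞, SliceGeneric I y J₀ c (w₁.2.1 ∪ w₂.2.1)) (h𝒟 : ∀ c ∈ 𝒞, ¬ OutsideGated I J₀ (w₁.2.1 ∪ w₂.2.1) c → c ∈ 𝒟)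
    (hcard : 𝒟.card + 2 ≤ 𝒞.card) : False := by
  classical
  have hU : 1 < (𝒞 \ 𝒟).card := by
    have := le_card_sdiff 𝒟 𝒞
    omega
  obtain ⟨a, ha, b, hb, hab⟩ := one_lt_card.1 hU
  obtain ⟨ha𝒞, ha𝒟⟩ := mem_sdiff.1 ha
  obtain ⟨hb𝒞, hb𝒟⟩ := mem_sdiff.1 hb
  have hOa : OutsideGated I J₀ (w₁.2.1 ∪ w₂.2.1) a := by by_contra h; exact ha𝒟 (h𝒟 a ha𝒞 h)
  have hOb : OutsideGated I J₀ (w₁.2.1 ∪ w₂.2.1) b := by by_contra h; exact hb𝒟 (h𝒟 b hb𝒞 h)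
  exact false_of_two_clean hI hT hS hB ht (h𝒞J ha𝒞) (h𝒞J hb𝒞) hab (hch a ha𝒞) (hch b hb𝒞) hOa hOb (hgen a ha𝒞) (hgen b hb𝒞)

/-- **THE DIRTY CHORDS OF A TERMINAL CORE OF BOUNDARY SLACK `t` NUMBER AT MOST `t`.** -/
theorem card_dirty_le_slack (hB : BoundaryExpanding r I) (ht : Terminal I r y J₀ w₁ w₂) {t : ℕ}
    (hslack : 2 * (bdry I J₀).card ≤ 3 * J₀.card + t) {𝒟 : Finset (Fin m)} (h𝒟J : 𝒟 ⊆ J₀) (hch : ∀ c ∈ 𝒟, IsChord I J₀ c)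
    (hdirty : ∀ c ∈ 𝒟, ¬ OutsideGated I J₀ (w₁.2.1 ∪ w₂.2.1) c) : 𝒟.card ≤ t := by
  classical
  rcases 𝒟.eq_empty_or_nonempty with h0 | ⟨c₀, hc₀⟩
  · rw [h0, card_empty]; exact Nat.zero_le _
  haveI : Nonempty (Fin n) := ⟨I.vars c₀ 0⟩
  haveI : Nonempty (Fin m) := ⟨c₀⟩
  have hd : ∀ c ∈ 𝒟, ∃ h, h ∈ w₁.2.1 ∪ w₂.2.1 ∧ ∃ v w : Fin n, (v = I.vars c 2 ∨ v = I.vars c 3) ∧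
      ((I.vars h 2 = v ∧ I.vars h 3 = w) ∨ (I.vars h 2 = w ∧ I.vars h 3 = v)) ∧ ∃ j ∈ J₀, w ∈ varSet I j := fun c hc => by
    obtain ⟨h, hh, v, w, hv, hp, hw⟩ := exists_inside_partner (hdirty c hc)
    exact ⟨h, hh, v, w, hv, hp, hw⟩
  choose! hm hhmG hvw using hd
  choose! vd wd hvd hpd hwd using hvw
  refine card_le_slack' I hB 𝒟 hm vd wd (fun c hc => (not_mem_and_card ht (hhmG c hc)).1) (fun c hc => hpd c hc)
    (fun c hc => ⟨c, h𝒟J hc, (priv_mem (hch c hc) (hvd c hc)).1⟩) (fun c hc => (priv_mem (hch c hc) (hvd c hc)).2)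
    (fun c hc => Or.inl (hwd c hc)) (fun c hc c' hc' e => ?_) ?_ hslack
  · by_contra hne
    exact priv_ne (h𝒟J hc) (h𝒟J hc') hne (hch c hc) (hch c' hc') (hvd c hc) (hvd c' hc') e
  · refine (card_le_card fun j hj => ?_).trans ht.2.2.2.2.2.1
    rcases mem_union.1 hj with hj | hj
    · exact mem_union_left _ (mem_union_left _ hj)
    · obtain ⟨c, hc, rfl⟩ := mem_image.1 hj
      rcases mem_union.1 (hhmG c hc) with h | h
      exacts [mem_union_left _ (mem_union_right _ h), mem_union_right _ h]

/-- **`t + 2` slice-generic chords kill a terminal core of boundary slack `t`** — the statement of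
`PstarChordReadSlackGeneral.false_of_generic_chords`, reproved in two lines (at most `t` of them are dirty, so two are clean; no matching), in the
form: a set `𝒞` of slice-generic chords with `#𝒞 ≥ t + 2` contains two outside-gated ones. -/
theorem exists_two_clean_of_generic (hB : BoundaryExpanding r I) (ht : Terminal I r y J₀ w₁ w₂) {t : ℕ}
    (hslack : 2 * (bdry I J₀).card ≤ 3 * J₀.card + t) {𝒞 : Finset (Fin m)} (h𝒞J : 𝒞 ⊆ J₀) (hch : ∀ c ∈ 𝒞, IsChord I J₀ c)
    (hcard : t + 2 ≤ 𝒞.card) :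
    ∃ a ∈ 𝒞, ∃ b ∈ 𝒞, a ≠ b ∧ OutsideGated I J₀ (w₁.2.1 ∪ w₂.2.1) a ∧ OutsideGated I J₀ (w₁.2.1 ∪ w₂.2.1) b := by
  classical
  set 𝒟 := 𝒞.filter fun c => ¬ OutsideGated I J₀ (w₁.2.1 ∪ w₂.2.1) c with h𝒟
  have hD := card_dirty_le_slack hB ht hslack ((filter_subset _ 𝒞).trans h𝒞J) (fun c hc => hch c (mem_filter.1 hc).1)
    (fun c hc => (mem_filter.1 hc).2) (𝒟 := 𝒟)
  have hU : 1 < (𝒞 \ 𝒟).card := by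
    have := le_card_sdiff 𝒟 𝒞
    omega
  obtain ⟨a, ha, b, hb, hab⟩ := one_lt_card.1 hU
  obtain ⟨ha𝒞, ha𝒟⟩ := mem_sdiff.1 ha
  obtain ⟨hb𝒞, hb𝒟⟩ := mem_sdiff.1 hb
  refine ⟨a, ha𝒞, b, hb𝒞, hab, ?_, ?_⟩
  · by_contra h; exact ha𝒟 (mem_filter.2 ⟨ha𝒞, h⟩)
  · by_contra h; exact hb𝒟 (mem_filter.2 ⟨hb𝒞, h⟩)

/-! ## The census node after the clean two-chord theorem -/

/-- **`TwoCleanGeneric` (OPEN): two outside-gated slice-generic chords on every centre structure.**  For every pure typed `(r,3/2)`-expanding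
instance with simple overlaps and every terminal core `(J₀, w₁, w₂)` carrying a non-empty leafless set of non-chords, there are two distinct chords
of `J₀`, both outside-gated and both slice-generic for the menu `G₁ ∪ G₂`.  Weaker than `GenericChords` (`twoCleanGeneric_of_genericChords`);
what separates it from "two slice-generic chords" is exactly the dirty chords.  FRONTIER (census side of O1). -/
@[conjecture] def TwoCleanGeneric : Prop :=
  ∀ (n m r : ℕ) (I : LocalMap 4 n m), I.IsPure xorAndPred → Typed I → SimpleOverlap I → BoundaryExpanding r I →
    ∀ (y : Fin m → Bool) (J₀ : Finset (Fin m)) (w₁ w₂ : Finset (Fin n) × Finset (Fin m) × Bool), Terminal I r y J₀ w₁ w₂ →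
      (∃ S ⊆ J₀, S.Nonempty ∧ (∀ w ∈ xverts I S, 2 ≤ xpdeg I S w) ∧ ∀ f ∈ S, ¬ IsChord I J₀ f) →
      ∃ cᵢ ∈ J₀, ∃ cⱼ ∈ J₀, cᵢ ≠ cⱼ ∧ IsChord I J₀ cᵢ ∧ IsChord I J₀ cⱼ ∧
        OutsideGated I J₀ (w₁.2.1 ∪ w₂.2.1) cᵢ ∧ OutsideGated I J₀ (w₁.2.1 ∪ w₂.2.1) cⱼ ∧
        SliceGeneric I y J₀ cᵢ (w₁.2.1 ∪ w₂.2.1) ∧ SliceGeneric I y J₀ cⱼ (w₁.2.1 ∪ w₂.2.1)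

/-- **`GenericChords` implies `TwoCleanGeneric`**: of `t + 2` slice-generic chords at most `t` are dirty. -/
theorem twoCleanGeneric_of_genericChords (h : GenericChords) : TwoCleanGeneric := by
  intro n m r I hI hT hS hB y J₀ w₁ w₂ ht hS₀
  obtain ⟨𝒞, h𝒞J, hch, hgen, hcount⟩ := h n m r I hI hT hS hB y J₀ w₁ w₂ ht hS₀
  have hexp := hB J₀ ht.2.2.1.le
  obtain ⟨a, ha, b, hb, hab, hOa, hOb⟩ :=
    exists_two_clean_of_generic hB ht (t := 𝒞.card - 2) (by omega) h𝒞J hch (by omega)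
  exact ⟨a, h𝒞J ha, b, h𝒞J hb, hab, hch a ha, hch b hb, hOa, hOb, hgen a ha, hgen b hb⟩

/-- **O1 FROM `TwoCleanGeneric`**: every terminal core has leaf-peelable non-chords. -/
theorem terminalPeelable_of_twoCleanGeneric (h : TwoCleanGeneric) : TerminalPeelable := by
  intro n m r I hI hT hS hB y J₀ w₁ w₂ ht
  by_contra hnp
  obtain ⟨S, hSJ, hne, hL, hnc⟩ := exists_centre_of_not_peelable I hnp
  obtain ⟨cᵢ, hcᵢ, cⱼ, hcⱼ, hne', hchᵢ, hchⱼ, hOᵢ, hOⱼ, hgenᵢ, hgenⱼ⟩ := h n m r I hI hT hS hB y J₀ w₁ w₂ ht ⟨S, hSJ, hne, hL, hnc⟩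
  exact false_of_two_clean hI hT hS hB ht hcᵢ hcⱼ hne' hchᵢ hchⱼ hOᵢ hOⱼ hgenᵢ hgenⱼ

end Summit.PneNP.PneNP.Theorems.PstarChordReadTwoCleanCount
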